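import Literature.AnabelianGeometry.SemiGraphs.TemperedPiRayLimitElement
import Literature.AnabelianGeometry.SemiGraphs.TemperedPiRayApartmentLevelFiniteness
import Literature.AnabelianGeometry.SemiGraphs.ThetaRayEscape
import Literature.AnabelianGeometry.SemiGraphs.TemperedPiPresentationInputs
import Literature.AnabelianGeometry.SemiGraphs.UniformSplittingStrictlyCoherentProofs
import HarnessLib

/-!
# The level data of the escape at `𝒢_θ`: the apartment generators along the ray ([SemiAnbd] Thm 3.7 (iii), p. 41)

Mochizuki, *Semi-graphs of anabelioids*, Publ. RIMS **42** (2006) [MochizukiSemiAnbd2006], Theorem 3.7 (iii)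
p. 41 ("a compatible system of vertices of `𝒢_{∞,j}` … fixed by `H`"); desk countermodel `𝒢_θ` of
abc-iut-L3-d1 (memo HOME/staging/L3/L3-d1/g3/COUNTERMODEL-Thm37iii-infinite.md, (2a)–(2c)).
[cite: MochizukiSemiAnbd2006, Thm 3.7(iii) p.41]

PROOF-ONLY file (abc-iut cell, FRONTIER programme REFUTE-F1732, brick R6 «LEVEL DATA at `thetaRay`»; seat
abc-iut-L3-t11 gen 3; no definitions, no named facts).  abc-iut-L3-d4's assembly
`thetaRay_not_compactInVerticialAt_of_levelEscape` (`ThetaRayEscape.lean`) refutes `CompactInVerticialAt` at the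
binder-form graph `thetaRay G E up low` from a SEQUENCE `z` in `π₁^temp` with four level-wise binders (hz)
(hfin) (hfar) (hcrit).  Here the sequence is made EXPLICIT — the edge generators of the apartment of the
canonical Galois tower along the ray (abc-iut-L3-t11's `TemperedPiRayApartment.lean`),
`z k := ψ_{k+1}(up e₀)` with `ψ_{k+1}` the decomposition homomorphism of the `(k+1)`-st apartment point sequence
— and three of the four binders are DISCHARGED for it, for ANY `G`, `E`, `up`, `low`:

* (hfin) ← abc-iut-w5-d160's `isOfFinOrder_proj_rayGen`; (hfar) ← `exists_fixed_height_le_rayGen`;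
* (hz) ← `eventually_proj_raySeq_succ_eq` (`TemperedPiRayLimitElement.lean`) from ONE group-theoretic binder
  (hcoin) «`(low (k+1) e₀)⁻¹ · up e₀` lies, for `k ≫ 0`, in the characteristic open core of `G` of any
  prescribed level `d`» — at `G = F̂₂⁽ᵖ⁾`, `up = α`, `low k = θ_{n_k} ∘ α` this is `b^{-p^{n_{k+1}}} ∈ charOpenCore`
  (R1b: `θ_m → id`) — together with the constancy of the fibre cardinality of each (finite) level of the
  canonical tower along the ray (abc-iut-L5-t16's `CovObj.nodeCard_eq_of_reachable`).

Results: `thetaRay_levelEscape_data` (the three binders for the explicit `z`) and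
`thetaRay_not_compactInVerticialAt_of_hcrit` / `thetaRay_not_compactInVerticial_of_hcrit` — `¬ CompactInVerticialAt
(thetaRay G E up low)` resp. `¬ CompactInVerticial.{0}` from `Thm37Hypotheses`, (hcoin) and the ONE remaining
binder (hcrit) «no `z_k`-fixed critical sub-joint at height `n+1` at deep levels, `k ≫ 0`» (abc-iut-L3-d4's
(c3)/(c5), `ThetaRayCriticalSubjoint.ray_not_critical_of_characters`, whose `hstab` input is abc-iut-L3-t11's
`PointSeq.exists_gal_conj_brHom_of_edgeMap_eq`).  Towards a kernel erratum for the ∀-countable reading of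
[SemiAnbd] Thm 3.7 (iii) ([IUTchI] Rmk 2.5.3); print proves finite `𝔾` (kernel:
`compactInVerticialAt_of_finiteGraph`); IUT uses finite dual semi-graphs only.  Nothing here bears on [IUTchIII]
Cor. 3.12; typed ≠ proved; no refutation is claimed in this file (two binders remain).
-/

noncomputable section

namespace Literature.AnabelianGeometry.SemiGraphs

open CategoryTheory Topology
open ProfiniteSemiGraph ProfiniteSemiGraph.GaloisLevelData

variable {G E : Type} [Group G] [TopologicalSpace G] [IsTopologicalGroup G] [CompactSpace G]
  [TotallyDisconnectedSpace G] [Group E] [TopologicalSpace E] [IsTopologicalGroup E] [CompactSpace E]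
  [TotallyDisconnectedSpace E] {up : E →ₜ* G} {low : ℕ → (E →ₜ* G)}

/-! ### The apartment of the canonical tower of `thetaRay` along the ray -/

/-- The branch `β_k⁻ = (k, false)` of the ray abuts to `v_k` (for the apartment constructor).
[cite: MochizukiSemiAnbd2006, §1 p.11] -/
theorem thetaRay_ham : ∀ k : ℕ, (thetaRay G E up low).graph.abuts (k, false) = some k := fun _ => rfl

/-- The branch `β_k⁺ = (k, true)` of the ray abuts to `v_{k+1}`. [cite: MochizukiSemiAnbd2006, §1 p.11] -/
theorem thetaRay_hap : ∀ k : ℕ, (thetaRay G E up low).graph.abuts (k, true) = some (k + 1) := fun _ => rfl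

/-- `β_k⁺` and `β_k⁻` are branches of the same edge `e_k`. [cite: MochizukiSemiAnbd2006, §1 p.11] -/
theorem thetaRay_hmp : ∀ k : ℕ, (thetaRay G E up low).graph.edgeOf ((k, true) : ℕ × Bool) =
    (thetaRay G E up low).graph.edgeOf ((k, false) : ℕ × Bool) := fun _ => rfl

/-- Along the ray every level of a Galois tower has constant vertex-fibre cardinality (the gluings are
bijections `S_{e_k} ≅ S_{v_k}`, `S_{e_k} ≅ S_{v_{k+1}}`; abc-iut-L5-t16's `nodeCard_eq_of_reachable`).
[cite: MochizukiSemiAnbd2006, §3 p.36] -/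
theorem thetaRay_card_SV_eq (S : CovObj (thetaRay G E up low)) (k : ℕ) :
    Nat.card (S.SV k).obj.V = Nat.card (S.SV (0 : ℕ)).obj.V :=
  (S.nodeCard_eq_of_reachable (SemiGraph.ray_reachable_vertex k)).symm

section LevelData

variable (h36 : (thetaRay G E up low).Prop36Hypotheses)
  (P₀ : ((thetaRay G E up low).galoisLevelData h36).PointSeq h36.isCountable (0 : ℕ)) (e₀ : E)

/-- **(hz) for the apartment generators of `thetaRay`**, from the group-theoretic coincidence binder
(hcoin): the level-`m` components of `z_{k+1} = ψ_{k+1}(low (k+1) e₀)` and `z_k = ψ_{k+1}(up e₀)` agree for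
`k ≫ 0`. [cite: MochizukiSemiAnbd2006, Thm 3.7(iii) p.41] -/
theorem thetaRay_hz_rayGen
    (hcoin : ∀ d : ℕ, ∃ N : ℕ, ∀ k, N ≤ k → (low (k + 1) e₀)⁻¹ * up e₀ ∈ charOpenCore G d) :
    ∀ m : ℕ, ∃ N : ℕ, ∀ k, N ≤ k →
      ((thetaRay G E up low).galoisLevelData h36).proj h36.isCountable m
          ((rayPointSeq (D := (thetaRay G E up low).galoisLevelData h36) thetaRay_ham thetaRay_hap
            thetaRay_hmp P₀ (k + 1 + 1)).decompHom
            ((thetaRay G E up low).brHom (k + 1, true) (k + 1 + 1) (thetaRay_hap (k + 1)) e₀)) =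
        ((thetaRay G E up low).galoisLevelData h36).proj h36.isCountable m
          ((rayPointSeq (D := (thetaRay G E up low).galoisLevelData h36) thetaRay_ham thetaRay_hap
            thetaRay_hmp P₀ (k + 1)).decompHom
            ((thetaRay G E up low).brHom (k, true) (k + 1) (thetaRay_hap k) e₀)) := by
  have hfinS : ∀ (m k : ℕ), Finite ((((thetaRay G E up low).galoisLevelData h36).S m).SV (k + 1)).obj.V :=
    fun m k => ((thetaRay G E up low).galoisLevelData_isFinite h36 m).finite_V (k + 1)
  refine eventually_proj_raySeq_succ_eq (D := (thetaRay G E up low).galoisLevelData h36)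
    (thetaRay_isConnected G E up low) thetaRay_ham thetaRay_hap thetaRay_hmp P₀ (fun _ => e₀) _
    (fun _ => rfl) hfinS fun m => ?_
  obtain ⟨N, hN⟩ := hcoin (Nat.card ((((thetaRay G E up low).galoisLevelData h36).S m).SV (0 : ℕ)).obj.V)
  refine ⟨N, fun k hk => ?_⟩
  rw [thetaRay_card_SV_eq]
  exact hN k hk

/-- **The level data of the escape for the explicit apartment generators `z k := ψ_{k+1}(up e₀)`**: the
three binders (hz), (hfin), (hfar) of `thetaRay_not_compactInVerticialAt_of_levelEscape` hold, given (hcoin).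
[cite: MochizukiSemiAnbd2006, Thm 3.7(iii) p.41] -/
theorem thetaRay_levelEscape_data
    (hcoin : ∀ d : ℕ, ∃ N : ℕ, ∀ k, N ≤ k → (low (k + 1) e₀)⁻¹ * up e₀ ∈ charOpenCore G d) :
    let D := (thetaRay G E up low).galoisLevelData h36
    let z : ℕ → D.temperedPi h36.isCountable := fun k =>
      (rayPointSeq (D := D) thetaRay_ham thetaRay_hap thetaRay_hmp P₀ (k + 1)).decompHom
        ((thetaRay G E up low).brHom (k, true) (k + 1) (thetaRay_hap k) e₀)
    (∀ j : ℕ, ∃ N : ℕ, ∀ k, N ≤ k →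
        D.proj h36.isCountable j (z (k + 1)) = D.proj h36.isCountable j (z k)) ∧
      (∀ j k : ℕ, IsOfFinOrder (D.proj h36.isCountable j (z k))) ∧
      (∀ k j : ℕ, ∃ x : (D.tree j).Vertex, k ≤ (D.treeProj j).vertexMap x ∧
        (D.treeAct h36.isCountable j (z k)).hom.vertexMap x = x) := by
  refine ⟨thetaRay_hz_rayGen h36 P₀ e₀ hcoin, fun j k => ?_, fun k j => ?_⟩
  · exact isOfFinOrder_proj_rayGen thetaRay_ham thetaRay_hap thetaRay_hmp P₀ k j e₀
  · exact exists_fixed_height_le_rayGen thetaRay_ham thetaRay_hap thetaRay_hmp P₀ (fun v : ℕ => v)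
      (fun k => Nat.le_succ k) k j e₀

end LevelData

/-! ### `¬ CompactInVerticialAt (thetaRay G E up low)` modulo (hcoin) and (hcrit) -/

/-- **The escape at `𝒢_θ` modulo (hcoin) and (hcrit)**: for `thetaRay G E up low` satisfying the hypotheses
of Thm 3.7, a base point sequence `P₀` over `v_0` of the canonical tower and `e₀ ∈ E`, if
`(low (k+1) e₀)⁻¹ · up e₀` eventually lies in every characteristic open core of `G` (hcoin) and the explicit
apartment generators `z k = ψ_{k+1}(up e₀)` fix no critical sub-joint at height `n+1` at deep levels for
`k ≫ 0` (hcrit, abc-iut-L3-d4's (c5)), then `CompactInVerticialAt (thetaRay G E up low)` fails.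
[cite: MochizukiSemiAnbd2006, Thm 3.7(iii) p.41] -/
theorem thetaRay_not_compactInVerticialAt_of_hcrit (h37 : (thetaRay G E up low).Thm37Hypotheses)
    (P₀ : ((thetaRay G E up low).galoisLevelData h37.toProp36Hypotheses).PointSeq h37.isCountable (0 : ℕ))
    (e₀ : E)
    (hcoin : ∀ d : ℕ, ∃ N : ℕ, ∀ k, N ≤ k → (low (k + 1) e₀)⁻¹ * up e₀ ∈ charOpenCore G d)
    (hcrit : let D := (thetaRay G E up low).galoisLevelData h37.toProp36Hypotheses
      let z : ℕ → D.temperedPi h37.isCountable := fun k =>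
        (rayPointSeq (D := D) thetaRay_ham thetaRay_hap thetaRay_hmp P₀ (k + 1)).decompHom
          ((thetaRay G E up low).brHom (k, true) (k + 1) (thetaRay_hap k) e₀)
      ∀ n : ℕ, ∃ j₀ : ℕ, ∀ j, j₀ ≤ j → ∃ N : ℕ, ∀ k, N ≤ k →
        ∀ (y : (D.tree j).Vertex) (b b' : (D.tree j).Branch),
          (D.tree j).abuts b = some y → (D.tree j).abuts b' = some y →
          (D.treeProj j).vertexMap y = n + 1 →
          (D.treeAct h37.isCountable j (z k)).hom.edgeMap ((D.tree j).edgeOf b) = (D.tree j).edgeOf b →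
          (D.treeAct h37.isCountable j (z k)).hom.edgeMap ((D.tree j).edgeOf b') = (D.tree j).edgeOf b' →
          (∃ (b₂ : (D.tree j).Branch) (v₂ : (D.tree j).Vertex), b₂ ≠ b ∧
            (D.tree j).edgeOf b₂ = (D.tree j).edgeOf b ∧ (D.tree j).abuts b₂ = some v₂ ∧
            (D.treeProj j).vertexMap v₂ = n + 2) →
          (∃ (b₂ : (D.tree j).Branch) (v₂ : (D.tree j).Vertex), b₂ ≠ b' ∧
            (D.tree j).edgeOf b₂ = (D.tree j).edgeOf b' ∧ (D.tree j).abuts b₂ = some v₂ ∧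
            (D.treeProj j).vertexMap v₂ = n) →
          False) :
    ¬ CompactInVerticialAt (thetaRay G E up low) := by
  obtain ⟨hz, hfin, hfar⟩ := thetaRay_levelEscape_data h37.toProp36Hypotheses P₀ e₀ hcoin
  exact thetaRay_not_compactInVerticialAt_of_levelEscape h37 _ hz hfin hfar hcrit

/-- … hence the ∀-countable named fact `CompactInVerticial.{0}` fails (modulo (hcoin), (hcrit) at one such
`thetaRay`). [cite: MochizukiSemiAnbd2006, Thm 3.7(iii) p.41] -/
theorem thetaRay_not_compactInVerticial_of_hcrit (h37 : (thetaRay G E up low).Thm37Hypotheses)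
    (P₀ : ((thetaRay G E up low).galoisLevelData h37.toProp36Hypotheses).PointSeq h37.isCountable (0 : ℕ))
    (e₀ : E)
    (hcoin : ∀ d : ℕ, ∃ N : ℕ, ∀ k, N ≤ k → (low (k + 1) e₀)⁻¹ * up e₀ ∈ charOpenCore G d)
    (hcrit : let D := (thetaRay G E up low).galoisLevelData h37.toProp36Hypotheses
      let z : ℕ → D.temperedPi h37.isCountable := fun k =>
        (rayPointSeq (D := D) thetaRay_ham thetaRay_hap thetaRay_hmp P₀ (k + 1)).decompHom
          ((thetaRay G E up low).brHom (k, true) (k + 1) (thetaRay_hap k) e₀)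
      ∀ n : ℕ, ∃ j₀ : ℕ, ∀ j, j₀ ≤ j → ∃ N : ℕ, ∀ k, N ≤ k →
        ∀ (y : (D.tree j).Vertex) (b b' : (D.tree j).Branch),
          (D.tree j).abuts b = some y → (D.tree j).abuts b' = some y →
          (D.treeProj j).vertexMap y = n + 1 →
          (D.treeAct h37.isCountable j (z k)).hom.edgeMap ((D.tree j).edgeOf b) = (D.tree j).edgeOf b →
          (D.treeAct h37.isCountable j (z k)).hom.edgeMap ((D.tree j).edgeOf b') = (D.tree j).edgeOf b' →
          (∃ (b₂ : (D.tree j).Branch) (v₂ : (D.tree j).Vertex), b₂ ≠ b ∧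
            (D.tree j).edgeOf b₂ = (D.tree j).edgeOf b ∧ (D.tree j).abuts b₂ = some v₂ ∧
            (D.treeProj j).vertexMap v₂ = n + 2) →
          (∃ (b₂ : (D.tree j).Branch) (v₂ : (D.tree j).Vertex), b₂ ≠ b' ∧
            (D.tree j).edgeOf b₂ = (D.tree j).edgeOf b' ∧ (D.tree j).abuts b₂ = some v₂ ∧
            (D.treeProj j).vertexMap v₂ = n) →
          False) :
    ¬ CompactInVerticial.{0} := fun hCV =>
  thetaRay_not_compactInVerticialAt_of_hcrit h37 P₀ e₀ hcoin hcrit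
    (ProfiniteSemiGraph.compactInVerticial_iff_forall_at.mp hCV _)

/-- A base point sequence over `v_0` of the canonical tower of `thetaRay` exists (abc-iut-L3-d2's and abc-iut-L3-t8's
`GaloisLevelData.nonempty_pointSeq`); for the (hcrit) producer, which must refer to a CHOSEN one.
[cite: MochizukiSemiAnbd2006, Thm 3.7(i) p.40] -/
theorem thetaRay_nonempty_pointSeq_zero (h36 : (thetaRay G E up low).Prop36Hypotheses) :
    Nonempty (((thetaRay G E up low).galoisLevelData h36).PointSeq h36.isCountable (0 : ℕ)) :=
  GaloisLevelData.nonempty_pointSeq h36 (0 : ℕ)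

end Literature.AnabelianGeometry.SemiGraphs

end
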